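import Mathlib.Analysis.Normed.Module.Ball.Homeomorph
import Literature.AlgebraicTopology.SingularHomology.FundamentalClassProofs
import Literature.AlgebraicTopology.SingularHomology.LocalHomologyVanishing
import Literature.AlgebraicTopology.SingularHomology.SphereComplement
import HarnessLib

/-!
# The collapse ("pinch") map `X → Sⁿ` of a Euclidean neighbourhood is an isomorphism on `Hₙ`

Topic `Literature/AlgebraicTopology/SingularHomology` (Hatcher, *Algebraic Topology*, §§2.2, 3.3).
For a Hausdorff space `X`, an open subset `U ⊆ X` and a homeomorphism `g : U ≃ₜ Y ∖ {p}` onto the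
complement of a point of a compact space `Y`, the **collapse map** `X → Y` (`g` on `U`, constant
`p` off `U`) is continuous; for `Y = Sⁿ = ℝⁿ ∪ {∞}` and `U ≅ ℝⁿ` a coordinate neighbourhood of a
topological `n`-manifold this is the quotient map `X → X/(X ∖ U) = Sⁿ` of Hatcher 2002, §2.2
(Example 2.31 ff., cellular boundary formula) and §3.3, Exercise 7 ("for `M` closed connected
orientable there is a degree `1` map `M → Sⁿ`"), and the maps `fᵢ : M → Sⁿ` in the proof of
Cor. A.9. We prove:

* `Literature.AlgebraicTopology.SingularHomology.continuous_collapseFun`, `Literature.AlgebraicTopology.SingularHomology.collapseMap` (the map as `C(X, Y)`), `Literature.AlgebraicTopology.SingularHomology.mapsTo_collapseMap`,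
  `Literature.AlgebraicTopology.SingularHomology.collapseMap_comp_subsetIncl` (it is `g` on `U`).
* `Literature.AlgebraicTopology.SingularHomology.isIso_map_collapseMap`: the collapse map induces isomorphisms
  `Hₖ(X | x; M) ≅ Hₖ(Y | g x; M)` on local homology at every `x ∈ U` (excision at the open sets
  `U`, `Y ∖ {p}` — `Literature.AlgebraicTopology.SingularHomology.localHomology.openSubsetIso` — and the homeomorphism `g`).
* `Literature.AlgebraicTopology.SingularHomology.isIso_toLocal_sphere`: `Hₙ(Sⁿ; M) → Hₙ(Sⁿ | y; M)` is an isomorphism for `n ≥ 1` (long exact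
  sequence of the pair `(Sⁿ, Sⁿ ∖ y)`, `Sⁿ ∖ y ≅ ℝⁿ` contractible; Hatcher §3.3, p. 236).
* `Literature.AlgebraicTopology.SingularHomology.isIso_toLocal_of_isFundamentalClass`: on a closed connected manifold with a fundamental
  class for an `R`-orientation, `Hₙ(X; R) → Hₙ(X | x; R)` is an isomorphism (Hatcher Thm. 3.26(a);
  injectivity is the proved Thm. 3.26(b) `…toLocal_injective_of_connectedSpace_holds`).
* `Literature.AlgebraicTopology.SingularHomology.exists_isOpen_homeomorph_euclideanSpace`: every point of a topological `n`-manifold has an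
  open neighbourhood homeomorphic to `ℝⁿ`.
* `Literature.AlgebraicTopology.SingularHomology.exists_isIso_map_sphere_of_isIso_toLocal`, `Literature.AlgebraicTopology.SingularHomology.exists_isIso_map_sphere_of_isFundamentalClass`
  (**main**): for `X : Type` Hausdorff with `U ≅ ℝⁿ` open around `x₀` and `Hₙ(X) → Hₙ(X | x₀)` an
  isomorphism — in particular for a closed connected `n`-manifold with a fundamental class — the
  collapse map `f : X → Sⁿ` induces an isomorphism `Hₙ(X; M) ≅ Hₙ(Sⁿ; M)` (it has degree `±1`), by
  the commutative square `Hₙ(X) → Hₙ(X | x₀) ≅ Hₙ(Sⁿ | f x₀) ← Hₙ(Sⁿ)`.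
* `Literature.AlgebraicTopology.SingularHomology.singularHomology.isIso_map_zero_of_pathConnectedSpace`: maps of path-connected spaces are
  isomorphisms on `H₀` (Hatcher Prop. 2.7).

This is the homological input of the characterisation of homotopy 4-spheres
(`SPC4.nonempty_homotopyEquiv_sphere_four_iff`, `spc4.S10`): the collapse map of a simply connected
closed 4-manifold with `H₂ = 0` is a homology isomorphism, hence (Whitehead) a homotopy equivalence.

## Design notes

* Universes: the collapse map and its local-homology statement are for `X Y : Type u`; the
  statements involving the round sphere `Sⁿ ⊂ ℝⁿ⁺¹` (which lives in `Type`) and a map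
  `X → Sⁿ` on homology need `X : Type`, since `Literature.AlgebraicTopology.SingularHomology.singularHomology.map` relates spaces of one
  universe.
* Coefficients `R`, `M` are arbitrary; the fundamental-class statement is over the ring `R`.
* No declaration in this file uses `sorry`.

## References

* A. Hatcher, *Algebraic Topology*, CUP 2002, §2.1 (Prop. 2.7, long exact sequence of the pair),
  §2.2 (degree, Example 2.31), §3.3 (p. 231, p. 236, Thm. 3.26, Exercise 7), Appendix Cor. A.9
  [HatcherAT2002].
-/

noncomputable section

open CategoryTheory Limits Set Function Metric Topology OpenPartialHomeomorph

universe u v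

namespace Literature.AlgebraicTopology.SingularHomology

/-- Local notation: `𝔼 n` is the model Euclidean space `EuclideanSpace ℝ (Fin n)`. -/
local notation "𝔼 " n:arg => EuclideanSpace ℝ (Fin n)

/-- Local notation: `𝕊 n` is the unit sphere in `EuclideanSpace ℝ (Fin (n + 1))`. -/
local notation "𝕊 " n:arg => (Metric.sphere (0 : EuclideanSpace ℝ (Fin (n + 1))) 1)

/-! ### The collapse map of an open subset identified with a punctured space -/

section Collapse

variable {X : Type u} {Y : Type v} [TopologicalSpace X] [TopologicalSpace Y]

open Classical in
/-- The **collapse map** of an open subset `U ⊆ X` identified with the complement of a point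
`p ∈ Y` by `g : U ≃ₜ Y ∖ {p}`: it is `g` on `U` and sends everything else to `p`. For `X` a closed
`n`-manifold, `U` a coordinate ball and `Y = Sⁿ = ℝⁿ ∪ {∞}` this is the classical degree-one
"pinch" map `X → X/(X ∖ U) ≅ Sⁿ` (Hatcher 2002, §2.2, Example 2.31 ff.; §3.3, Exercise 7:
"for M closed connected orientable there is a degree 1 map M → Sⁿ"). [cite: HatcherAT2002, §3.3 Exercise 7] -/
def collapseFun (U : Set X) (p : Y) (g : U ≃ₜ (({p}ᶜ : Set Y))) (x : X) : Y :=
  if hx : x ∈ U then (g ⟨x, hx⟩ : Y) else p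

variable {U : Set X} {p : Y} {g : U ≃ₜ (({p}ᶜ : Set Y))}

/-- On `U` the collapse map is `g`. [folklore] -/
lemma collapseFun_of_mem {x : X} (hx : x ∈ U) : collapseFun U p g x = g ⟨x, hx⟩ := by
  rw [collapseFun, dif_pos hx]

/-- Off `U` the collapse map is constant `p`. [folklore] -/
lemma collapseFun_of_not_mem {x : X} (hx : x ∉ U) : collapseFun U p g x = p := by
  rw [collapseFun, dif_neg hx]

/-- On `U` the collapse map does not take the value `p`. [folklore] -/
lemma collapseFun_ne_of_mem {x : X} (hx : x ∈ U) : collapseFun U p g x ≠ p := by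
  rw [collapseFun_of_mem hx]
  exact (g ⟨x, hx⟩).2

/-- The collapse map is continuous when `U` is open, `X` is Hausdorff and `Y` is compact: near a
point outside `U` it takes values in any neighbourhood `V` of `p` off the compact set
`g⁻¹(Y ∖ V)`. [folklore] -/
theorem continuous_collapseFun [T2Space X] [CompactSpace Y] (hU : IsOpen U) :
    Continuous (collapseFun U p g) := by
  rw [continuous_iff_continuousAt]
  intro x
  by_cases hx : x ∈ U
  · have hc : ContinuousOn (collapseFun U p g) U := by
      rw [continuousOn_iff_continuous_restrict]
      have h : U.restrict (collapseFun U p g) = fun z => (g z : Y) := by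
        ext z
        simp [collapseFun_of_mem z.2]
      rw [h]
      exact continuous_subtype_val.comp g.continuous
    exact hc.continuousAt (hU.mem_nhds hx)
  · rw [ContinuousAt, collapseFun_of_not_mem hx, _root_.tendsto_nhds]
    intro V hV hpV
    set K : Set (({p}ᶜ : Set Y)) := Subtype.val ⁻¹' Vᶜ with hK
    have hKc : IsCompact K := by
      rw [Subtype.isCompact_iff]
      have himage : Subtype.val '' K = Vᶜ := by
        rw [hK, Subtype.image_preimage_coe, inter_eq_right]
        intro y hy hyp
        exact hy (hyp ▸ hpV)
      rw [himage]
      exact hV.isClosed_compl.isCompact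
    set C : Set X := (fun y : (({p}ᶜ : Set Y)) => ((g.symm y : U) : X)) '' K with hC
    have hCc : IsCompact C := hKc.image (continuous_subtype_val.comp g.symm.continuous)
    have hxC : x ∉ C := fun ⟨y, _, hy⟩ => hx (hy ▸ (g.symm y).2)
    filter_upwards [hCc.isClosed.isOpen_compl.mem_nhds hxC] with z hz
    by_cases hzU : z ∈ U
    · rw [mem_preimage, collapseFun_of_mem hzU]
      by_contra hzV
      exact hz ⟨g ⟨z, hzU⟩, hzV, by simp⟩
    · rw [mem_preimage, collapseFun_of_not_mem hzU]
      exact hpV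

/-- The collapse map `X → Y` of `g : U ≃ₜ Y ∖ {p}`, `U ⊆ X` open, as a continuous map
(Hatcher 2002, §3.3, Exercise 7; §2.2, the quotient maps `X → X/A`). [cite: HatcherAT2002, §3.3 Exercise 7] -/
def collapseMap [T2Space X] [CompactSpace Y] (hU : IsOpen U) (p : Y) (g : U ≃ₜ (({p}ᶜ : Set Y))) :
    C(X, Y) :=
  ⟨collapseFun U p g, continuous_collapseFun hU⟩

variable [T2Space X] [CompactSpace Y] (hU : IsOpen U) (p : Y) (g : U ≃ₜ (({p}ᶜ : Set Y)))

/-- Unfolding `collapseMap`. [folklore] -/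
@[simp]
lemma collapseMap_apply (x : X) : collapseMap hU p g x = collapseFun U p g x := rfl

/-- On `U` the collapse map is `g`. [folklore] -/
lemma collapseMap_apply_of_mem {x : X} (hx : x ∈ U) : collapseMap hU p g x = g ⟨x, hx⟩ :=
  collapseFun_of_mem hx

/-- Off `U` the collapse map is constant `p`. [folklore] -/
lemma collapseMap_apply_of_not_mem {x : X} (hx : x ∉ U) : collapseMap hU p g x = p :=
  collapseFun_of_not_mem hx

/-- Off `x ∈ U`, the collapse map avoids the value at `x`. [folklore] -/
lemma mapsTo_collapseMap {x : X} (hx : x ∈ U) :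
    MapsTo (collapseMap hU p g) ({x}ᶜ : Set X) ({(g ⟨x, hx⟩ : Y)}ᶜ : Set Y) := by
  intro z hz h
  rw [mem_singleton_iff, collapseMap_apply] at h
  by_cases hzU : z ∈ U
  · rw [collapseFun_of_mem hzU] at h
    exact hz (congrArg Subtype.val (g.injective (Subtype.val_injective h)) :)
  · rw [collapseFun_of_not_mem hzU] at h
    exact (g ⟨x, hx⟩).2 h.symm

/-- On `U` the collapse map is `g` followed by the inclusion `Y ∖ {p} ⊆ Y`. [folklore] -/
lemma collapseMap_comp_subsetIncl :
    (collapseMap hU p g).comp (subsetIncl U) = (subsetIncl (({p}ᶜ : Set Y))).comp (g : C(U, ({p}ᶜ : Set Y))) := by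
  ext z
  simp [collapseFun_of_mem z.2]

end Collapse

/-! ### The collapse map is an isomorphism on local homology -/

section LocalHomology

variable (R : Type v) [CommRing R] (M : Type v) [AddCommGroup M] [Module R M]
variable {X Y : Type u} [TopologicalSpace X] [TopologicalSpace Y] [T2Space X] [CompactSpace Y]
  [T1Space Y] {U : Set X} (hU : IsOpen U) (p : Y) (g : U ≃ₜ (({p}ᶜ : Set Y)))

/-- **The collapse map induces isomorphisms on local homology at points of `U`**:
`Hₖ(X | x; M) ≅ Hₖ(Y | g x; M)` for `x ∈ U`, since it restricts to the homeomorphism `g` between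
the open neighbourhoods `U` of `x` and `Y ∖ {p}` of `g x`, and local homology sees only a
neighbourhood (excision, Hatcher 2002, §3.3, p. 231). [cite: HatcherAT2002, §3.3 p. 231] -/
theorem isIso_map_collapseMap {x : X} (hx : x ∈ U) (k : ℕ) :
    IsIso (relativeSingularHomology.map R M (collapseMap hU p g) (mapsTo_collapseMap hU p g hx) k) := by
  have hg : MapsTo (g : C(U, ({p}ᶜ : Set Y))) ({(⟨x, hx⟩ : U)}ᶜ : Set U)
      ({g ⟨x, hx⟩}ᶜ : Set ({p}ᶜ : Set Y)) :=
    fun y hy h => hy (g.injective (mem_singleton_iff.1 h))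
  have key : (localHomology.openSubsetIso R M hU hx k).hom ≫
      relativeSingularHomology.map R M (collapseMap hU p g) (mapsTo_collapseMap hU p g hx) k =
      (localHomology.mapIso R M g ⟨x, hx⟩ k).hom ≫
        (localHomology.openSubsetIso R M isOpen_compl_singleton (g ⟨x, hx⟩).2 k).hom := by
    change relativeSingularHomology.map R M _ _ k ≫ _ =
      relativeSingularHomology.map R M _ hg k ≫ relativeSingularHomology.map R M _ _ k
    rw [← relativeSingularHomology.map_comp, ← relativeSingularHomology.map_comp]
    congr 1
    exact collapseMap_comp_subsetIncl hU p g
  rw [(Iso.eq_inv_comp _).2 key]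
  infer_instance

end LocalHomology

/-! ### Degree zero -/

section DegreeZero

variable (R : Type v) [CommRing R] (M : Type v) [AddCommGroup M] [Module R M]
variable {X Y : Type u} [TopologicalSpace X] [TopologicalSpace Y]

/-- A map between path-connected spaces is an isomorphism on `H₀` (Hatcher 2002, Prop. 2.7: both
augmentations are isomorphisms and are compatible). [cite: HatcherAT2002, Prop. 2.7] -/
theorem singularHomology.isIso_map_zero_of_pathConnectedSpace [PathConnectedSpace X]
    [PathConnectedSpace Y] (f : C(X, Y)) : IsIso (singularHomology.map R M f 0) := by
  haveI : IsIso (singularHomology.ε R M Y) := singularHomology.isIso_ε_of_pathConnectedSpace R M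
  haveI : IsIso (singularHomology.ε R M X) := singularHomology.isIso_ε_of_pathConnectedSpace R M
  have h : singularHomology.map R M f 0 =
      singularHomology.ε R M X ≫ inv (singularHomology.ε R M Y) := by
    rw [← singularHomology.map_ε (R := R) (M := M) f, Category.assoc, IsIso.hom_inv_id,
      Category.comp_id]
  rw [h]
  infer_instance

end DegreeZero

/-! ### Spheres: `Hₙ(Sⁿ) → Hₙ(Sⁿ | y)` is an isomorphism -/

section Sphere

variable (R : Type v) [CommRing R] (M : Type v) [AddCommGroup M] [Module R M]
variable {n : ℕ}

/-- `Sⁿ` is path connected for `n ≥ 1` (Mathlib `isPathConnected_sphere`). [folklore] -/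
theorem pathConnectedSpace_sphere (hn : n ≠ 0) : PathConnectedSpace (𝕊 n) := by
  refine isPathConnected_iff_pathConnectedSpace.mp (isPathConnected_sphere ?_ 0 zero_le_one)
  rw [← Module.finrank_eq_rank, finrank_euclideanSpace_fin]
  exact_mod_cast (show 1 < n + 1 by omega)

/-- A punctured sphere `Sⁿ ∖ {y} ≅ ℝⁿ` is contractible. [folklore] -/
theorem contractibleSpace_sphere_compl_singleton (y : 𝕊 n) :
    ContractibleSpace (({y}ᶜ : Set (𝕊 n))) :=
  (SphereComplement.sphereMinusPointHomeomorph y).contractibleSpace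

/-- A punctured sphere `Sⁿ ∖ {y} ≅ ℝⁿ` is path connected. [folklore] -/
theorem pathConnectedSpace_sphere_compl_singleton (y : 𝕊 n) :
    PathConnectedSpace (({y}ᶜ : Set (𝕊 n))) := by
  haveI := contractibleSpace_sphere_compl_singleton y
  infer_instance

/-- **`Hₙ(Sⁿ; M) → Hₙ(Sⁿ | y; M)` is an isomorphism** for `n ≥ 1` and every `y ∈ Sⁿ`: in the
long exact sequence of the pair `(Sⁿ, Sⁿ ∖ {y})`, `Sⁿ ∖ {y} ≅ ℝⁿ` is contractible, so
`Hₙ(Sⁿ ∖ y) = 0` and `Hₙ₋₁(Sⁿ ∖ y) → Hₙ₋₁(Sⁿ)` is injective (zero source for `n ≥ 2`, an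
isomorphism of `H₀`'s for `n = 1`) (Hatcher 2002, §3.3, p. 236, Example: "`Sⁿ` ... the map
`Hₙ(Sⁿ) → Hₙ(Sⁿ | x)` is an isomorphism"; §2.1, long exact sequence of the pair).
[cite: HatcherAT2002, §3.3 p. 236] -/
theorem isIso_toLocal_sphere (hn : n ≠ 0) (y : 𝕊 n) :
    IsIso (singularHomology.toLocal R M y n) := by
  obtain ⟨m, rfl⟩ : ∃ m, n = m + 1 := ⟨n - 1, by omega⟩
  set A : Set (𝕊 (m + 1)) := {y}ᶜ with hA
  haveI := contractibleSpace_sphere_compl_singleton y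
  haveI := pathConnectedSpace_sphere_compl_singleton y
  haveI := pathConnectedSpace_sphere (n := m + 1) hn
  -- `j_* : Hₙ(Sⁿ) → Hₙ(Sⁿ, A)` is `toLocal`
  change IsIso (relativeSingularHomology.ofAbsolute R M (𝕊 (m + 1)) A (m + 1))
  -- mono: `Hₙ(A) = 0`
  have hmono : Mono (relativeSingularHomology.ofAbsolute R M (𝕊 (m + 1)) A (m + 1)) :=
    (relativeSingularHomology.exact_map_ofAbsolute R M A (m + 1)).mono_g
      ((isZero_singularHomology_of_contractibleSpace R M (X := A) (Nat.succ_ne_zero m)).eq_of_src _ _)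
  -- epi: `∂ = 0` since `Hₘ(A) → Hₘ(Sⁿ)` is a monomorphism
  have hι : Mono (singularHomology.map R M (⟨Subtype.val, continuous_subtype_val⟩ : C(A, 𝕊 (m + 1))) m) := by
    rcases Nat.eq_zero_or_pos m with hm | hm
    · subst hm
      haveI := singularHomology.isIso_map_zero_of_pathConnectedSpace R M
        (⟨Subtype.val, continuous_subtype_val⟩ : C(A, 𝕊 (0 + 1)))
      infer_instance
    · exact ⟨fun _ _ _ =>
        (isZero_singularHomology_of_contractibleSpace R M (X := A) hm.ne').eq_of_tgt _ _⟩
  have hδ : relativeSingularHomology.δ R M (𝕊 (m + 1)) A m = 0 := by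
    rw [← cancel_mono (singularHomology.map R M
      (⟨Subtype.val, continuous_subtype_val⟩ : C(A, 𝕊 (m + 1))) m), zero_comp,
      relativeSingularHomology.δ_comp_map]
  have hepi : Epi (relativeSingularHomology.ofAbsolute R M (𝕊 (m + 1)) A (m + 1)) :=
    (relativeSingularHomology.exact_ofAbsolute_δ R M A m).epi_f hδ
  exact isIso_of_mono_of_epi _

end Sphere

/-! ### Closed manifolds: `Hₙ(X) → Hₙ(X | x)` from a fundamental class; Euclidean neighbourhoods -/

section Manifold

variable (R : Type v) [CommRing R] (M : Type v) [AddCommGroup M] [Module R M]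
variable {n : ℕ} {X : Type u} [TopologicalSpace X]

/-- **`Hₙ(X; R) → Hₙ(X | x; R)` is an isomorphism on a closed connected `R`-oriented manifold**
(Hatcher 2002, §3.3, Thm. 3.26(a)), GIVEN a fundamental class `c` for the orientation `μ`
(Thm. 3.26(a), existence: the named fact `existsUnique_isFundamentalClass`): injectivity is
Thm. 3.26(b) (`singularHomology.toLocal_injective_of_connectedSpace_holds`, proved), and the image
contains the generator `μₓ = c|ₓ` of `Hₙ(X | x; R) ≅ R`. [cite: HatcherAT2002, Thm. 3.26(a)] -/
theorem isIso_toLocal_of_isFundamentalClass [CompactSpace X] [T2Space X]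
    [ChartedSpace (𝔼 n) X] [ConnectedSpace X] (μ : HomologicalOrientation R X n)
    {c : singularHomology R R X n} (hc : IsFundamentalClass μ c) (x : X) :
    IsIso (singularHomology.toLocal R R x n) := by
  refine (ConcreteCategory.isIso_iff_bijective _).2 ⟨?_, fun y => ?_⟩
  · exact singularHomology.toLocal_injective_of_connectedSpace_holds R R X n x
  · obtain ⟨e, he⟩ := μ.isGenerator x
    refine ⟨e y • c, ?_⟩
    change singularHomology.toLocal R R x n (e y • c) = y
    rw [map_smul, hc x]
    apply e.injective
    rw [map_smul, he, smul_eq_mul, mul_one]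

/-- Every point of a topological `n`-manifold has an open neighbourhood homeomorphic to `ℝⁿ`
(a coordinate ball; Hatcher 2002, §3.3, p. 231, definition of a manifold). [folklore] -/
theorem exists_isOpen_homeomorph_euclideanSpace [ChartedSpace (𝔼 n) X] (x₀ : X) :
    ∃ U : Set X, IsOpen U ∧ x₀ ∈ U ∧ Nonempty (U ≃ₜ 𝔼 n) := by
  set φ := chartAt (𝔼 n) x₀ with hφ
  obtain ⟨r, hr, hball⟩ : ∃ r > 0, ball (φ x₀) r ⊆ φ.target :=
    Metric.isOpen_iff.1 φ.open_target _ (mem_chart_target _ x₀)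
  set ψ : OpenPartialHomeomorph X (𝔼 n) := φ.trans (univBall (φ x₀) r).symm with hψ
  have htarget : ψ.target = univ := by
    rw [hψ, OpenPartialHomeomorph.trans_target, OpenPartialHomeomorph.symm_target, univBall_source,
      univ_inter, OpenPartialHomeomorph.symm_symm, eq_univ_iff_forall]
    intro v
    have hv : univBall (φ x₀) r v ∈ (univBall (φ x₀) r).target :=
      (univBall (φ x₀) r).map_source (by simp)
    rw [univBall_target _ hr] at hv
    exact hball hv
  refine ⟨ψ.source, ψ.open_source, ?_, ⟨ψ.toHomeomorphSourceTarget.trans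
    ((Homeomorph.setCongr htarget).trans (Homeomorph.Set.univ (𝔼 n)))⟩⟩
  rw [hψ, OpenPartialHomeomorph.trans_source, OpenPartialHomeomorph.symm_source,
    univBall_target _ hr]
  exact ⟨mem_chart_source _ x₀, mem_ball_self hr⟩

end Manifold

/-! ### The collapse map of a closed oriented manifold is an isomorphism on `Hₙ` -/

section Main

variable (R : Type v) [CommRing R] (M : Type v) [AddCommGroup M] [Module R M]
variable {n : ℕ} {X : Type} [TopologicalSpace X] [T2Space X]

/-- **A map `f : X → Sⁿ` inducing an isomorphism `Hₙ(X; M) ≅ Hₙ(Sⁿ; M)`**, for `X` Hausdorff with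
an open subset `U ≅ ℝⁿ` containing a point `x₀` at which `Hₙ(X; M) → Hₙ(X | x₀; M)` is an
isomorphism (`n ≥ 1`, `p ∈ Sⁿ` the point onto which `X ∖ U` is collapsed): the collapse map `f`
of `U` fits into the commutative square
`Hₙ(X) → Hₙ(X | x₀) ≅ Hₙ(Sⁿ | f x₀) ← Hₙ(Sⁿ)` whose other three sides are isomorphisms
(Hatcher 2002, §3.3, Exercise 7 with Prop. 2.30 / local degree, Prop. 2.30 ff.).
[cite: HatcherAT2002, §3.3 Exercise 7] -/
theorem exists_isIso_map_sphere_of_isIso_toLocal (hn : n ≠ 0) {U : Set X} (hU : IsOpen U)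
    (e : U ≃ₜ 𝔼 n) {x₀ : X} (hx₀ : x₀ ∈ U) (hloc : IsIso (singularHomology.toLocal R M x₀ n))
    (p : 𝕊 n) :
    ∃ f : C(X, 𝕊 n), (∀ x ∉ U, f x = p) ∧ IsIso (singularHomology.map R M f n) := by
  set g : U ≃ₜ (({p}ᶜ : Set (𝕊 n))) := e.trans (SphereComplement.sphereMinusPointHomeomorph p).symm
  refine ⟨collapseMap hU p g, fun x hx => collapseMap_apply_of_not_mem hU p g hx, ?_⟩
  have hsq := relativeSingularHomology.ofAbsolute_comp_map R M (collapseMap hU p g)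
    (mapsTo_collapseMap hU p g hx₀) n
  haveI := isIso_map_collapseMap R M hU p g hx₀ n
  haveI := isIso_toLocal_sphere R M hn (g ⟨x₀, hx₀⟩ : 𝕊 n)
  haveI := hloc
  have h : singularHomology.map R M (collapseMap hU p g) n =
      singularHomology.toLocal R M x₀ n ≫ relativeSingularHomology.map R M (collapseMap hU p g)
        (mapsTo_collapseMap hU p g hx₀) n ≫ inv (singularHomology.toLocal R M (g ⟨x₀, hx₀⟩ : 𝕊 n) n) := by
    rw [← Category.assoc]
    exact (IsIso.eq_comp_inv _).2 hsq.symm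
  rw [h]
  infer_instance

/-- **Closed connected oriented `n`-manifolds map to `Sⁿ` by an `Hₙ`-isomorphism** (`n ≥ 1`,
`X : Type`): GIVEN a fundamental class `c` of an `R`-orientation `μ` of the closed connected
`n`-manifold `X` (Hatcher 2002, Thm. 3.26(a)), the collapse map `f : X → Sⁿ` of a coordinate ball
induces an isomorphism `Hₙ(X; R) ≅ Hₙ(Sⁿ; R)` — i.e. `f` has degree `±1`
(Hatcher 2002, §3.3, Exercise 7). [cite: HatcherAT2002, §3.3 Exercise 7 and Thm. 3.26] -/
theorem exists_isIso_map_sphere_of_isFundamentalClass (hn : n ≠ 0) [CompactSpace X]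
    [ChartedSpace (𝔼 n) X] [ConnectedSpace X] (μ : HomologicalOrientation R X n)
    {c : singularHomology R R X n} (hc : IsFundamentalClass μ c) :
    ∃ f : C(X, 𝕊 n), IsIso (singularHomology.map R R f n) := by
  obtain ⟨x₀⟩ := (inferInstance : Nonempty X)
  obtain ⟨U, hU, hx₀, ⟨e⟩⟩ := exists_isOpen_homeomorph_euclideanSpace (n := n) x₀
  obtain ⟨f, -, hf⟩ := exists_isIso_map_sphere_of_isIso_toLocal R R hn hU e hx₀
    (isIso_toLocal_of_isFundamentalClass R μ hc x₀) ⟨EuclideanSpace.single (Fin.last n) 1, by simp⟩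
  exact ⟨f, hf⟩

end Main

end Literature.AlgebraicTopology.SingularHomology

end
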